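import Summits.BirchSwinnertonDyer.BirchSwinnertonDyer.Theorems.ByReductionTypeAtTwoSupersingularFlatBlindHondaOfKernelValue
import HarnessLib

/-!
# Route `ByReductionTypeAtTwo` (rung K4), crux `SupersingularRankZeroAtTwo` (item stmt-BirchSwinnertonDyer-19097):
# **THE QUANTITATIVE WRONSKIAN CRITERION AT THE BLIND CHARACTER** — slot 5's Honda rung CDF±_H (line
# `Cruxes/SupersingularRankZeroAtTwo/Lines/odd_blind_package.lean` v2.6.1 18db34093d095bfe :898) follows from ONE ODD COEFFICIENT:
# the linear coefficient of the Coleman Wronskian `a₀b₁ − a₁b₀` of some two functionals — seat `bsd-2adic-ss-1`, GEN 19, LEAD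
# attack (L3), part 3 (sequel of p810801 (Y) and p810939 (K₈))

HONEST FRAMING (cell `bsd-2adic`): THEOREMS ONLY; no definition, no named fact, no `sorry`, no instance.  Nothing booked
(D-0054); BSD is not proved by any of this; the odd-slope statement (D₁) itself is NOT proved here (it is the residual, the
`p = 2` twin of the tree's SES-KP cokernel clause).  PARTITION: X5@2 good-ss r₀, `a₂ = ±2` × p = 2 — types-the-object-of;
closes none. bears_on: K4 (item 19097).

## What is proved

* §1 (`Λ₂ = ℤ₂⟦T⟧`) `not_four_dvd_evalAt_negTwo_of_not_two_dvd_coeff_one`: `F(0) = 0` and `coeff₁ F` odd ⟹ `4 ∤ F(−2)`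
  (`F = T·G`, `F(−2) = −2·G(−2)`, `G(−2) ≡ G(0) = coeff₁F (mod 2)`).
* §2 (generic base, any `(a, g, c)` with levels) ★ `exists_mem_colemanKer_flat_not_eight_dvd_of_wronskian`: two functionals
  `z₀, z₁` with Coleman values `(a₀, b₀)`, `(a₁, b₁)` and `8 ∤ (a₀b₁ − a₁b₀)(−2)` give `z ∈ Ker Col♭` with `8 ∤ z(g·c₁) − z(c₁)` —
  the (K₈)-witness of p810939 (`z = b₁•z₀ − b₀•z₁` by `Λ`-linearity, Coleman value `(a₀b₁ − a₁b₀, 0)`, and p800827's identity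
  `Col♯(z)(−2) = z(g·c₁) − z(c₁)`); the quantitative form of p800827's ★★ `exists_mem_colemanKer_flat_apply_ne_of_wronskian`.
* §3 (generic base, HONDA SYSTEM AT TWO) ★ `constantCoeff_eq_of_isHondaSystemAtTwo` — THE `p = 2` CONSTANT-TERM LINE: every Coleman
  value `(A, B)` of a functional `z` has `(A(0), B(0)) = −z(c₋)·(λ, μ)`, `λ = a³ − 2a² − 3a + 4`, `μ = a² − 2a − 1` (levels `0`
  and `1` of Def. 5.9 with `u₀ = 0, v₀ = 1, u₁ = 1, v₁ = 0` and the two bottom relations of `IsHondaSystemAtTwo`; the odd-`p` line is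
  `ℤ_p·(a(a−2) − (p−1), a − 2)`, tree `IsColemanPair.constantCoeff_eq`); hence `wronskian_constantCoeff_eq_zero`: every Coleman
  Wronskian vanishes at `T = 0`, and ★★ `exists_mem_colemanKer_flat_not_eight_dvd_of_odd_slope`: **(D₁) «some Wronskian has ODD
  linear coefficient» ⟹ (K₈)**.
* §4 (over `ℚ`, `v ∋ 2`) ★★ `flatBlindLocalTransversalityHondaOffZeroAtTwo_of_oddSlope`: **(D₁) ⟹ CDF±_H** with the rung's body
  VERBATIM as conclusion (via p810939's `…_of_kernelValue`).
The residual (D₁) is the `p = 2` twin of the tree's `IsColemanPair.wronskian_constantCoeff_eq_zero_and_dvd` +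
`exists_addMonoidHom_pair_det_not_dvd` + a RANK input (odd `p`: `HondaOrbitRankOfSurjectiveProofs`, «IsHondaSystem encodes
generation but never rank»): the linear coefficient of the Wronskian is, mod `2`, a `2 × 2` determinant of values at two explicit
points, odd for a separating pair of functionals once `E(ℚ_{2,v})` is known to have `ℤ₂`-rank `4`.

## References
* [Sprung2012] F. Sprung, J. Number Theory 132 (2012): Def. 3.1 (p. 1489), Def. 5.9 (p. 1495), Def. 7.1–7.2 (p. 1500), Def. 7.9
  (p. 1503), §2 p. 1486 (Λ-linearity); Thm. 2.2 (p. 1487).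
* [Sprung2017] F. Sprung, ANT 11 (2017), Cor. 4.4 (`u₀ = 0, v₀ = 1, u₁ = 1, v₁ = 0`).
* [KuriharaPollack2007] Prop. 1.2 (the joint cokernel `Λ/(T)`, odd `p`).
* Tree: p800827 (`OddBlindLocal.evalAt_negTwo_sharp_of_isColemanPair_of_mem`), p810801, p810939, `Sprung2012/{ColemanMapLambdaActionProofs
  (IsColemanPair.exists_mul), ColemanTwistProofs (IsColemanPair.sub, toIwasawa_cyclotomicOmega), ColemanMapJointCokernelProofs}.lean`,
  `Rank1Residual/Supersingular/BlindPointDerivAt.lean` (`evalAt`).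
-/

set_option autoImplicit false
set_option linter.dupNamespace false

noncomputable section

open scoped Classical NumberField

universe u

namespace Summit.BirchSwinnertonDyer.BirchSwinnertonDyer.Theorems

namespace OddBlindLocal

open NumberField IsDedekindDomain Literature.NumberTheory.EllipticCurves Literature.NumberTheory.GaloisRepresentations
  ZpExtension Literature.NumberTheory.EllipticCurves.Kobayashi2003 Literature.NumberTheory.EllipticCurves.Sprung2017
  Literature.NumberTheory.EllipticCurves.Sprung2012 Literature.NumberTheory.EllipticCurves.Rank1Residual
  Summit.BirchSwinnertonDyer.Rank1Residual.F1Sign2 Summit.BirchSwinnertonDyer.Rank1Residual.Supersingular.BlindLever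

/-! ## §1 `Λ₂`: an odd linear coefficient and a zero constant term force `4 ∤ F(−2)` -/

/-- For `G ∈ ℤ₂⟦T⟧`: `G(−2) ≡ G(0) (mod 2)`, in the form `G(−2) = G(0) + 2·r`. [folklore] -/
theorem exists_evalAt_negTwo_eq_constantCoeff_add (G : PowerSeries ℤ_[2]) :
    ∃ r : ℤ_[2], evalAt (-2 : ℤ_[2]) G = PowerSeries.constantCoeff G + 2 * r := by
  refine ⟨-evalAt (-2 : ℤ_[2]) (PowerSeries.mk fun p ↦ PowerSeries.coeff (p + 1) G), ?_⟩
  conv_lhs => rw [PowerSeries.eq_X_mul_shift_add_const G]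
  rw [evalAt_add norm_neg_two_lt_one, evalAt_mul norm_neg_two_lt_one, evalAt_X, evalAt_C]
  ring

/-- **`F(0) = 0` and `coeff₁ F` odd ⟹ `4 ∤ F(−2)`** in `Λ₂ = ℤ₂⟦T⟧`: `F = T·G` with `G(0) = coeff₁ F`, so
`F(−2) = −2·G(−2) = −2·coeff₁F − 4r`. [folklore] -/
theorem not_four_dvd_evalAt_negTwo_of_not_two_dvd_coeff_one {F : PowerSeries ℤ_[2]}
    (h0 : PowerSeries.constantCoeff F = 0) (h1 : ¬ (2 : ℤ_[2]) ∣ PowerSeries.coeff 1 F) :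
    ¬ (4 : ℤ_[2]) ∣ evalAt (-2 : ℤ_[2]) F := by
  set G : PowerSeries ℤ_[2] := PowerSeries.mk fun p ↦ PowerSeries.coeff (p + 1) F with hG
  have hF : F = PowerSeries.X * G := by
    conv_lhs => rw [PowerSeries.eq_X_mul_shift_add_const F, h0, map_zero, add_zero]
  have hG0 : PowerSeries.constantCoeff G = PowerSeries.coeff 1 F := by
    rw [hG, ← PowerSeries.coeff_zero_eq_constantCoeff_apply, PowerSeries.coeff_mk]
  obtain ⟨r, hr⟩ := exists_evalAt_negTwo_eq_constantCoeff_add G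
  rw [hF, evalAt_mul norm_neg_two_lt_one, evalAt_X, hr, hG0]
  rintro ⟨t, ht⟩
  apply h1
  exact ⟨-t - r, mul_left_cancel₀ (two_ne_zero : (2 : ℤ_[2]) ≠ 0) (by linear_combination -ht)⟩

/-! ## §2 Generic base: the quantitative Wronskian criterion at `−2` -/

section Generic

variable {K : Type u} [Field K] {κ : ZpExtension K 2}
variable {E : Type u} [Field E] [Algebra K E] {ι : AlgebraicClosure K →ₐ[K] AlgebraicClosure E}
variable {W : WeierstrassCurve K}

/-- ★ **QUANTITATIVE WRONSKIAN CRITERION.**  Two functionals `z₀, z₁` on `E(K_∞·K_v)` with Coleman values `(a₀, b₀)`, `(a₁, b₁)`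
(points `c_n` of level `n`, `g` a local lift of the topological generator) whose Wronskian satisfies `8 ∤ (a₀b₁ − a₁b₀)(−2)` yield
`z ∈ Ker Col♭` with `8 ∤ z(g·c₁) − z(c₁)` — the (K₈)-witness: `z = b₁•z₀ − b₀•z₁` has Coleman value `(a₀b₁ − a₁b₀, 0)` and
`Col♯(z)(−2) = z(g·c₁) − z(c₁)`. [cite: Sprung2012, Def. 5.9 (p. 1495), Def. 7.9 (p. 1503) and §2 p. 1486 (Λ-linearity)] -/
theorem exists_mem_colemanKer_flat_not_eight_dvd_of_wronskian {ap : ℤ} {g : Field.absoluteGaloisGroup E}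
    (hg : κ.IsTopGenerator (resGalOfEmb ι g)) {c : ℕ → localPoints W E}
    (hc : ∀ n, c n ∈ localLayerPointsOfEmb κ ι W n)
    {z₀ z₁ : localTowerPointsOfEmb κ ι W →+ ℤ_[2]} {a₀ b₀ a₁ b₁ : IwasawaAlgebra 2}
    (h₀ : IsColemanPair κ ι W ap g c z₀ a₀ b₀) (h₁ : IsColemanPair κ ι W ap g c z₁ a₁ b₁)
    (hW : ¬ (8 : ℤ_[2]) ∣ evalAt (-2 : ℤ_[2]) (a₀ * b₁ - a₁ * b₀)) :
    ∃ z ∈ colemanKer κ ι W ap g c .flat,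
      ¬ (8 : ℤ_[2]) ∣ z ⟨g • c 1, smul_mem_localTowerPointsOfEmb κ ι W g
          (localLayerPointsOfEmb_le_localTowerPointsOfEmb κ ι W 1 (hc 1))⟩ -
        z ⟨c 1, localLayerPointsOfEmb_le_localTowerPointsOfEmb κ ι W 1 (hc 1)⟩ := by
  have hc1 := localLayerPointsOfEmb_le_localTowerPointsOfEmb κ ι W 1 (hc 1)
  obtain ⟨w₀, hw₀⟩ := h₀.exists_mul hg hc b₁
  obtain ⟨w₁, hw₁⟩ := h₁.exists_mul hg hc b₀
  have hz : IsColemanPair κ ι W ap g c (w₀ - w₁) (b₁ * a₀ - b₀ * a₁) (b₁ * b₀ - b₀ * b₁) := hw₀.sub hw₁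
  have hb : b₁ * b₀ - b₀ * b₁ = 0 := by ring
  rw [hb] at hz
  refine ⟨w₀ - w₁, ⟨b₁ * a₀ - b₀ * a₁, 0, hz, rfl⟩, ?_⟩
  rw [← evalAt_negTwo_sharp_of_isColemanPair_of_mem hc1 hz, show b₁ * a₀ - b₀ * a₁ = a₀ * b₁ - a₁ * b₀ by ring]
  exact hW

end Generic

/-! ## §3 Generic base, Honda system at two: the constant-term line and the odd-slope criterion -/

section Honda

variable {K : Type u} [Field K] {κ : ZpExtension K 2}
variable {E : Type u} [Field E] [Algebra K E] {ι : AlgebraicClosure K →ₐ[K] AlgebraicClosure E}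
variable {W : WeierstrassCurve K}

/-- **The level-one trace relation of a Honda system at two, as a point identity**: `c₁ + g·c₁ = λ·c₋` with
`λ = a(a² − 2a − 1) + (4 − 2a) = a³ − 2a² − 3a + 4` (`Tr_{1/0}c₁ = a·c₀ + (4−2a)c₋`, `c₀ = (a²−2a−1)c₋`, `Tr_{1/0} = 1 + g`).
[cite: Sprung2012, Thm. 2.2 (1)–(2) (p. 1487)] -/
theorem add_smul_eq_of_isHondaSystemAtTwo {a : ℤ} {g : Field.absoluteGaloisGroup E}
    (hg : κ.IsTopGenerator (resGalOfEmb ι g)) {cneg : localPoints W E} {c : ℕ → localPoints W E}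
    (hH : IsHondaSystemAtTwo κ ι W a g cneg c) :
    c 1 + g • c 1 = (a * (a ^ 2 - 2 * a - 1) + (4 - 2 * a)) • cneg := by
  obtain ⟨-, hcn, hc0, htr1, -⟩ := hH
  have htr : localTraceOfEmb κ ι W 0 1 (c 1) = c 1 + g • c 1 := by
    rw [localTraceOfEmb_succ_eq_sum_pow_smul κ ι W hg 0 (hcn 1)]
    simp only [Finset.sum_range_succ, Finset.sum_range_zero, zero_add, pow_zero, one_mul, pow_one, one_smul]
  rw [← htr, htr1, hc0, smul_smul, ← add_smul]

/-- The constant term of a level-one orbit sum: `P_{1,x}(z)(0) = z(x) + z(g·x)`. [cite: Sprung2012, Def. 3.1 (p. 1489) (unfolding)] -/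
theorem constantCoeff_pairingSum_one (A : AddSubgroup (localPoints W E)) (g : Field.absoluteGaloisGroup E)
    (x : localPoints W E) (z : A →+ ℤ_[2]) :
    PowerSeries.constantCoeff (pairingSum W A g 1 x z) = evalOn W A z x + evalOn W A z (g • x) := by
  rw [pairingSum_def, pow_one, Finset.sum_range_succ, Finset.sum_range_succ, Finset.sum_range_zero, zero_add,
    pow_zero, pow_zero, one_smul, mul_one, pow_one, pow_one, map_add, PowerSeries.constantCoeff_C, map_mul,
    PowerSeries.constantCoeff_C, map_add, map_one, PowerSeries.constantCoeff_X, add_zero, mul_one]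

/-- ★ **THE `p = 2` CONSTANT-TERM LINE.**  For a Honda system at two `(c₋, c)` with parameter `a`, `g` a local lift of the
topological generator, and ANY functional `z` on `E(K_∞·K_v)` with a Coleman value `(A, B)`:
`A(0) = −λ·z(c₋)` and `B(0) = −μ·z(c₋)`, `λ = a(a²−2a−1) + (4−2a)`, `μ = a² − 2a − 1` — the image of `Col` modulo `T`
lies on the line `ℤ₂·(λ, μ)` (for `a = 2`: `(−2, −1)`; for `a = −2`: `(−6, 7)`).  Level `0` (`u₀ = 0`, `v₀ = 1`,
`ω₀ = T`): `T ∣ z(c₀) + B`; level `1` (`u₁ = 1`, `v₁ = 0`, `ω₁(0) = 0`): `0 = P_{1,c₁}(z)(0) + A(0) = z(c₁) + z(g·c₁) + A(0)`.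
The odd-`p` twin is the tree's `IsColemanPair.constantCoeff_eq` (line `ℤ_p·(a(a−2)−(p−1), a−2)`).
[cite: Sprung2012, Def. 5.9 (p. 1495), Def. 7.2 (p. 1500), Thm. 2.2 (p. 1487)] [cite: Sprung2017, Cor. 4.4] -/
theorem constantCoeff_eq_of_isHondaSystemAtTwo {a : ℤ} {g : Field.absoluteGaloisGroup E}
    (hg : κ.IsTopGenerator (resGalOfEmb ι g)) {cneg : localPoints W E} {c : ℕ → localPoints W E}
    (hH : IsHondaSystemAtTwo κ ι W a g cneg c)
    {z : localTowerPointsOfEmb κ ι W →+ ℤ_[2]} {A B : IwasawaAlgebra 2} (hz : IsColemanPair κ ι W a g c z A B) :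
    PowerSeries.constantCoeff A =
        -(((a * (a ^ 2 - 2 * a - 1) + (4 - 2 * a) : ℤ) : ℤ_[2]) *
          z ⟨cneg, localLayerPointsOfEmb_le_localTowerPointsOfEmb κ ι W 0 hH.1⟩) ∧
      PowerSeries.constantCoeff B =
        -(((a ^ 2 - 2 * a - 1 : ℤ) : ℤ_[2]) * z ⟨cneg, localLayerPointsOfEmb_le_localTowerPointsOfEmb κ ι W 0 hH.1⟩) := by
  have hle := fun n ↦ localLayerPointsOfEmb_le_localTowerPointsOfEmb κ ι W n
  have hcneg : cneg ∈ localTowerPointsOfEmb κ ι W := hle 0 hH.1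
  have hc0 : c 0 = (a ^ 2 - 2 * a - 1) • cneg := hH.2.2.1
  have hc0mem : c 0 ∈ localTowerPointsOfEmb κ ι W := by rw [hc0]; exact AddSubgroup.zsmul_mem _ hcneg _
  have hc1 : c 1 ∈ localTowerPointsOfEmb κ ι W := hle 1 (hH.2.1 1)
  have hgc1 : g • c 1 ∈ localTowerPointsOfEmb κ ι W := smul_mem_localTowerPointsOfEmb κ ι W g hc1
  constructor
  · -- level `1`
    have h := hz 1
    rw [sharpPoly_one, flatPoly_one, map_one, map_zero, one_mul, zero_mul, add_zero] at h
    obtain ⟨q, hq⟩ := h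
    have h0 := congrArg PowerSeries.constantCoeff hq
    rw [map_add, constantCoeff_pairingSum_one, map_mul, toIwasawa_cyclotomicOmega, map_sub, map_pow, map_add,
      map_one, PowerSeries.constantCoeff_X, add_zero, one_pow, sub_self, zero_mul, evalOn_of_mem W _ z hc1,
      evalOn_of_mem W _ z hgc1, ← map_add] at h0
    have e : (⟨c 1, hc1⟩ : localTowerPointsOfEmb κ ι W) + ⟨g • c 1, hgc1⟩ =
        (a * (a ^ 2 - 2 * a - 1) + (4 - 2 * a)) • ⟨cneg, hcneg⟩ := by
      apply Subtype.ext
      change c 1 + g • c 1 = (a * (a ^ 2 - 2 * a - 1) + (4 - 2 * a)) • cneg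
      exact add_smul_eq_of_isHondaSystemAtTwo hg hH
    rw [e, map_zsmul, zsmul_eq_mul] at h0
    linear_combination h0
  · -- level `0`
    have h := hz 0
    rw [sharpPoly_zero, flatPoly_zero, map_zero, map_one, zero_mul, one_mul, zero_add, pairingSum_def, pow_zero,
      Finset.sum_range_one, pow_zero, pow_zero, one_smul, mul_one, toIwasawa_cyclotomicOmega, pow_zero, pow_one,
      add_sub_cancel_left, evalOn_of_mem W _ z hc0mem] at h
    have h0 := PowerSeries.X_dvd_iff.mp h
    rw [map_add, PowerSeries.constantCoeff_C] at h0
    have e : (⟨c 0, hc0mem⟩ : localTowerPointsOfEmb κ ι W) = (a ^ 2 - 2 * a - 1) • ⟨cneg, hcneg⟩ := by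
      apply Subtype.ext
      change c 0 = (a ^ 2 - 2 * a - 1) • cneg
      exact hc0
    rw [e, map_zsmul, zsmul_eq_mul] at h0
    linear_combination h0

/-- **Every Coleman Wronskian of a Honda system at two vanishes at `T = 0`**: both `(a₀(0), b₀(0))` and `(a₁(0), b₁(0))` lie on
the line `ℤ₂·(λ, μ)`. [cite: Sprung2012, Def. 5.9 (p. 1495), Def. 7.2 (p. 1500)] -/
theorem wronskian_constantCoeff_eq_zero {a : ℤ} {g : Field.absoluteGaloisGroup E}
    (hg : κ.IsTopGenerator (resGalOfEmb ι g)) {cneg : localPoints W E} {c : ℕ → localPoints W E}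
    (hH : IsHondaSystemAtTwo κ ι W a g cneg c)
    {z₀ z₁ : localTowerPointsOfEmb κ ι W →+ ℤ_[2]} {a₀ b₀ a₁ b₁ : IwasawaAlgebra 2}
    (h₀ : IsColemanPair κ ι W a g c z₀ a₀ b₀) (h₁ : IsColemanPair κ ι W a g c z₁ a₁ b₁) :
    PowerSeries.constantCoeff (a₀ * b₁ - a₁ * b₀) = 0 := by
  obtain ⟨ha₀, hb₀⟩ := constantCoeff_eq_of_isHondaSystemAtTwo hg hH h₀
  obtain ⟨ha₁, hb₁⟩ := constantCoeff_eq_of_isHondaSystemAtTwo hg hH h₁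
  rw [map_sub, map_mul, map_mul, ha₀, hb₀, ha₁, hb₁]
  ring

/-- ★★ **(D₁) ⟹ (K₈): an ODD LINEAR COEFFICIENT of one Coleman Wronskian gives the mod-8 kernel value.**  For a Honda system at two,
`g` a local lift of the topological generator, and two functionals with Coleman values `(a₀, b₀)`, `(a₁, b₁)` such that
`coeff₁(a₀b₁ − a₁b₀)` is ODD: some `z ∈ Ker Col♭` has `8 ∤ z(g·c₁) − z(c₁)` (indeed `4 ∤`: the Wronskian is `T·(unit)` to first
order, and `(T·G)(−2) = −2·G(−2)` with `G(−2) ≡ G(0) (mod 2)`).  The `p = 2` twin of the tree's cokernel criterion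
`IsColemanPair.forall_exists_isColemanPair_X_mul_of_det` read at the blind character. [cite: Sprung2012, Def. 5.9 (p. 1495), Def. 7.9 (p. 1503)]
[cite: KuriharaPollack2007, Prop. 1.2] -/
theorem exists_mem_colemanKer_flat_not_eight_dvd_of_odd_slope {a : ℤ} {g : Field.absoluteGaloisGroup E}
    (hg : κ.IsTopGenerator (resGalOfEmb ι g)) {cneg : localPoints W E} {c : ℕ → localPoints W E}
    (hH : IsHondaSystemAtTwo κ ι W a g cneg c)
    {z₀ z₁ : localTowerPointsOfEmb κ ι W →+ ℤ_[2]} {a₀ b₀ a₁ b₁ : IwasawaAlgebra 2}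
    (h₀ : IsColemanPair κ ι W a g c z₀ a₀ b₀) (h₁ : IsColemanPair κ ι W a g c z₁ a₁ b₁)
    (hodd : ¬ (2 : ℤ_[2]) ∣ PowerSeries.coeff 1 (a₀ * b₁ - a₁ * b₀)) :
    ∃ z ∈ colemanKer κ ι W a g c .flat,
      ¬ (8 : ℤ_[2]) ∣ z ⟨g • c 1, smul_mem_localTowerPointsOfEmb κ ι W g
          (localLayerPointsOfEmb_le_localTowerPointsOfEmb κ ι W 1 (hH.2.1 1))⟩ -
        z ⟨c 1, localLayerPointsOfEmb_le_localTowerPointsOfEmb κ ι W 1 (hH.2.1 1)⟩ := by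
  refine exists_mem_colemanKer_flat_not_eight_dvd_of_wronskian hg hH.2.1 h₀ h₁ fun h8 ↦ ?_
  exact not_four_dvd_evalAt_negTwo_of_not_two_dvd_coeff_one (wronskian_constantCoeff_eq_zero hg hH h₀ h₁) hodd
    (dvd_trans ⟨2, by norm_num⟩ h8)

end Honda

/-! ## §4 Over `ℚ` at `v ∋ 2`: (D₁) ⟹ CDF±_H, the rung's body VERBATIM -/

section Rat

/-- ★★ **(D₁) ⟹ CDF±_H.**  If for every Honda system at two (`W/ℚ` globally minimal, `GoodSS W 2`, `a₂ ≠ 0`, `κ` cyclotomic, `v ∋ 2`,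
`g`, `c`) SOME two functionals on `E(ℚ_{∞,v})` have Coleman values whose Wronskian has an ODD linear coefficient — the `p = 2`
shape of «the joint Coleman map has cokernel `Λ/(T)`» (Kurihara–Pollack (SES-KP) at odd `p`; tree
`Sprung2012.forall_exists_isColemanPair_X_mul_rat` modulo its rank input) — then the Honda rung CDF±_H of slot 5 holds; the
conclusion is VERBATIM the body of `OddBlindPackage.FlatBlindLocalTransversalityHondaOffZeroAtTwo` (v2.6.1 :898–925).
[cite: Sprung2012, Def. 5.9 (p. 1495), Def. 7.9 (p. 1503), Open Problem 7.22 (p. 1505)] [cite: KuriharaPollack2007, Prop. 1.2] -/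
theorem flatBlindLocalTransversalityHondaOffZeroAtTwo_of_oddSlope
    (hD : ∀ (W : WeierstrassCurve ℚ) [W.IsElliptic] [W.IsGloballyMinimal],
      GoodSS W 2 → W.frobeniusTrace 2 ≠ 0 →
      ∀ (κ : ZpExtension ℚ 2), κ.IsCyclotomic →
      ∀ (v : HeightOneSpectrum (𝓞 ℚ)), (2 : 𝓞 ℚ) ∈ v.asIdeal →
      ∀ (g : Field.absoluteGaloisGroup (v.adicCompletion ℚ)) (c : ℕ → localPoints W (v.adicCompletion ℚ)),
        κ.IsTopGenerator (resGalOfEmb (closureEmb (K := ℚ) (v.adicCompletion ℚ)) g) →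
        (∀ n, c n ∈ localLayerPointsOfEmb κ (closureEmb (K := ℚ) (v.adicCompletion ℚ)) W n) →
        (∃ cneg : localPoints W (v.adicCompletion ℚ),
          Summit.BirchSwinnertonDyer.Rank1Residual.F1Sign2.IsHondaSystemAtTwo κ (closureEmb (K := ℚ) (v.adicCompletion ℚ)) W
            (W.frobeniusTrace 2) g cneg c) →
        ∃ (z₀ z₁ : localTowerPointsOfEmb κ (closureEmb (K := ℚ) (v.adicCompletion ℚ)) W →+ ℤ_[2])
          (a₀ b₀ a₁ b₁ : IwasawaAlgebra 2),
          IsColemanPair κ (closureEmb (K := ℚ) (v.adicCompletion ℚ)) W (W.frobeniusTrace 2) g c z₀ a₀ b₀ ∧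
          IsColemanPair κ (closureEmb (K := ℚ) (v.adicCompletion ℚ)) W (W.frobeniusTrace 2) g c z₁ a₁ b₁ ∧
          ¬ (2 : ℤ_[2]) ∣ PowerSeries.coeff 1 (a₀ * b₁ - a₁ * b₀)) :
    ∀ (W : WeierstrassCurve ℚ) [W.IsElliptic] [W.IsGloballyMinimal],
    ¬ W.HasCM → GoodSS W 2 → W.frobeniusTrace 2 ≠ 0 → W.rootNumber * ZMod.χ₈ (W.conductorNorm ℤ : ZMod 8) = -1 →
    ∀ (κ : ZpExtension ℚ 2) (γ : Field.absoluteGaloisGroup ℚ),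
      κ.IsCyclotomic → κ.IsTopGenerator γ → IsCyclotomicVariable 2 γ →
    ∀ (v : HeightOneSpectrum (𝓞 ℚ)), (2 : 𝓞 ℚ) ∈ v.asIdeal →
    ∀ (g : Field.absoluteGaloisGroup (v.adicCompletion ℚ)) (c : ℕ → localPoints W (v.adicCompletion ℚ)),
      κ.IsTopGenerator (resGalOfEmb (closureEmb (K := ℚ) (v.adicCompletion ℚ)) g) →
      (∀ n, c n ∈ localLayerPointsOfEmb κ (closureEmb (K := ℚ) (v.adicCompletion ℚ)) W n) →
      (∀ n, 1 ≤ n → localTraceOfEmb κ (closureEmb (K := ℚ) (v.adicCompletion ℚ)) W n (n + 1)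
        (c (n + 1)) = W.frobeniusTrace 2 • c n - c (n - 1)) →
      (∀ z₀ : localLayerPointsOfEmb κ (closureEmb (K := ℚ) (v.adicCompletion ℚ)) W 0 →+ ℤ_[2],
        evalOn W (localLayerPointsOfEmb κ (closureEmb (K := ℚ) (v.adicCompletion ℚ)) W 0) z₀ (c 0) = 0 →
          z₀ = 0) →
      (∀ a : ℤ_[2],
        (∃ z₀ : localLayerPointsOfEmb κ (closureEmb (K := ℚ) (v.adicCompletion ℚ)) W 0 →+ ℤ_[2],
          evalOn W (localLayerPointsOfEmb κ (closureEmb (K := ℚ) (v.adicCompletion ℚ)) W 0) z₀ (c 0) = 2 * a) →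
        ∃ y : localLayerPointsOfEmb κ (closureEmb (K := ℚ) (v.adicCompletion ℚ)) W 0 →+ ℤ_[2],
          evalOn W (localLayerPointsOfEmb κ (closureEmb (K := ℚ) (v.adicCompletion ℚ)) W 0) y (c 0) = a) →
      (∃ cneg : localPoints W (v.adicCompletion ℚ),
        Summit.BirchSwinnertonDyer.Rank1Residual.F1Sign2.IsHondaSystemAtTwo κ (closureEmb (K := ℚ) (v.adicCompletion ℚ)) W
          (W.frobeniusTrace 2) g cneg c) →
      ∀ (y : localPoints W (v.adicCompletion ℚ))
        (hy : y ∈ localLayerPointsOfEmb κ (closureEmb (K := ℚ) (v.adicCompletion ℚ)) W 1), g • y = -y →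
        ∀ k : ℕ, (∀ w ∈ localLayerPointsOfEmb κ (closureEmb (K := ℚ) (v.adicCompletion ℚ)) W 1, 2 ^ k • w ≠ y) →
          ∃ z ∈ colemanKer κ (closureEmb (K := ℚ) (v.adicCompletion ℚ)) W (W.frobeniusTrace 2) g c .flat,
            ¬ (2 : ℤ_[2]) ^ (k + 1) ∣
              z ⟨y, localLayerPointsOfEmb_le_localTowerPointsOfEmb κ (closureEmb (K := ℚ) (v.adicCompletion ℚ)) W 1 hy⟩ := by
  refine flatBlindLocalTransversalityHondaOffZeroAtTwo_of_kernelValue fun W _ _ hss ha κ hκ v hv g c hg hc hH ↦ ?_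
  obtain ⟨z₀, z₁, a₀, b₀, a₁, b₁, h₀, h₁, hodd⟩ := hD W hss ha κ hκ v hv g c hg hc hH
  obtain ⟨cneg, hH⟩ := hH
  exact exists_mem_colemanKer_flat_not_eight_dvd_of_odd_slope hg hH h₀ h₁ hodd

end Rat

end OddBlindLocal

end Summit.BirchSwinnertonDyer.BirchSwinnertonDyer.Theorems

end
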